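import Summits.BirchSwinnertonDyer.BirchSwinnertonDyer.Theorems.KimAtThreeShallowEqDeepMultTwoExpFineKato
import Summits.BirchSwinnertonDyer.BirchSwinnertonDyer.Theorems.KimAtThreeDeepUpperRiderOfCompat
import Summits.BirchSwinnertonDyer.BirchSwinnertonDyer.Theorems.KimAtThreeDeepUpperLocalLatticeUniform
import Literature.NumberTheory.EllipticCurves.ManinConstantAdditivePrimesProofs
import HarnessLib

/-!
# Route `KimAtThreeKolyvagin` (W2): the fine Kato package (C1′₂) of the non-additive non-anomalous rows DERIVED
# from the DEFINED-KATO package (C1ₑₓ) of the deep cruxes — read with the EXACT crude exponent `b = 1` and a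
# `3`-adic unit constant — so that 19599 / 19077's multiplicative and good non-anomalous `t = 0` rows rest on
# the SAME displayed object as 19075 / 19076 / 19562 / 19679

Cell `bsd-addord`, seat `bsd-addord-w2-c4` (gen 10; OWNER of crux 19599 `ShallowEqDeepOffKatoStratum`, item
19077 `ShallowEqDeepAtTorsionFree`).  `--supports` 19599.  HONEST FRAMING: END-TYPE TOOL THEOREMS WITH
DISPLAYED HYPOTHESES (no definition, no named fact, no instance, no `sorry`).  Kato's value datum `Λ` and the
scalar dual exponential `φ = exp*_ω` at `ℚ₃` are ABSTRACT binders; the package tying them is DISPLAYED; nothing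
asserted about any curve, nothing booked; 19560 / 19599 / 19077 stay OPEN; BSD is not proved by any of this.
Credit: the derivation tools are seat w2-c3 gen 7's (`KimAtThreeDeepUpperRiderOfCompat.rider₂_of_compat`,
`KimAtThreeDeepUpperLocalLatticeUniform`) on seat kim3 gen 13's `hker`/`hdual` texts and team n1011's
`range_padicLog_eq_span_zpow_of_isMinimal`; the two-exponent currency is seat acc6's.

## What, and why

Seat w2-c3's uniform road rests the deep cruxes on (C1ₑₓ) (`KimAtThreeDeepUpperOfDefinedKatoUniform` §2): per
tower row `(ι, κK, Λ, φ)` with `κK ≠ 0`, `hker` ([BK90] 3.8/3.11), `hdual` (Tate duality + [BK90] 3.8, lattice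
form), the crude compatibility X1-int_b `∃ b, 3^b·(φ(h) ⊗ 1 − Λ_{0,r}(y)) ∈ 3^{j+1}L_int`, and Kato's `ZetaBody`
family; its own docstring records the truth `b = 1` for Kato's witnesses (`3·exp*_ω(H¹(K_𝔓,T)) ⊆ 𝒪_{K_𝔓}`,
`K_𝔓/ℚ₃` unramified, ANY reduction type).  THIS FILE shows that the `b = 1` reading, together with R-κ
(`κK` a rational `3`-adic unit — crux 19560's clause (a)), already gives gen 10's (C1′₂) with NO digit lost on the
`E(ℚ₃)[3] = 0` rows: `hdual` + `log_ω(E(ℚ₃)) = 3^{1+t−v₃(c₃)−v₃#Ẽ_ns(𝔽₃)}ℤ₃` force `exp*_ω(H¹(ℚ₃,T)) =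
3^{λ₀}ℤ₃` with `λ₀ = v₃(c₃) + v₃(#Ẽ_ns(𝔽₃)) − 1 ≥ −1` (§1–§2), and `rider₂_of_compat` at `(a, b, t) = (1, 1, 0)`
yields the two-exponent rider for `3•Λ` at `(0, e)`, `e = 1 + λ₀ ≥ 0` — i.e. RIDER₂ at `(1, e)` for `Λ` (§3).
* §1 `padicValNat_card_torsion_eq_zero_of_card_torsionBy_eq_one` — `#G[p] = 1 ⇒ p ∤ #G_tors` (Cauchy).
* §2 `exists_normalised_of_dual_of_torsionBy` — from `hdual` at `t = 0`: `φ = 3^{λ₀}φ′`, `φ′` integral and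
  onto `ℤ₃`, with **`−1 ≤ λ₀`** (w2-c3's `exists_normalised_of_dual` with the exponent made explicit).
* §3 **`fineKato₁₂_of_definedKatoUnit`** — (C1ₑₓ¹ᵘ) at the row ⟹ (C1′₂) at the row, (C1ₑₓ¹ᵘ) := (C1ₑₓ) with
  `b := 1` and `∃ u : ℚ, u = κK ∧ v₃(u) = 0` added.
* §4 `portUnlockedTwoExp_of_definedKatoUnit_of_nonanomalous`, `shallowEqDeep_row_…`, `leaf_row_…`,
  `lower_row_of_definedKatoUnit_of_nonanomalous` — gen 10's `KimAtThreeShallowEqDeepMultTwoExpFineKato` on §3: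
  the unlocked port and the rows of 19599 / 19077 / LEAF / 19679 at a non-additive NON-ANOMALOUS `t = 0` tower
  row ⟸ PUB ∧ non-anomaly ∧ (C1ₑₓ¹ᵘ) ALONE.
READING (08-28): (C1ₑₓ¹ᵘ) ⟹ (C1ₑₓ) trivially, so ONE displayed object (the planner's Variant-EX text with
`b := 1` and R-κ) now carries 19075 / 19076 / 19562 / 19679 on every row AND 19599 / 19077 on every
non-additive non-anomalous `t = 0` row; left on their own spellings: the good ANOMALOUS rows ((C1_τ), gen 9 —
the Euler-factor lattice is finer than `3⁻¹𝒪`) and the additive-defect rows ((C1₂), seat acc3).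
References: [BlochKato1990] §3 (Prop. 3.8, Ex. 3.11); [Kato2004Asterisque] (8.1.3), §9.4, Thm. 9.7, Thm. 6.6 (1),
Ex. 13.3; [Kim2022StructureSelmer] §3.2.3, Lemma 3.3/3.10/3.11, Thm. 3.13; [MazurRubin2004] App. A;
[SilvermanAEC2009] IV.6.4, VII.2.1, VII.6.1–6.3, C.14; memo HOME/w2c4/W2C4-MULT-TWOEXP-g10.md §5.
-/

set_option autoImplicit false
-- the Theorems namespace of a single-conjunct summit repeats the summit name by design (D-0017)
set_option linter.dupNamespace false

noncomputable section

open scoped NumberField TensorProduct ContRepresentation Classical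
open CategoryTheory Field Function Finset IsDedekindDomain NumberField WeierstrassCurve
open Rat.HeightOneSpectrum
open Literature.NumberTheory.GaloisRepresentations Literature.NumberTheory.GaloisCohomology
open Literature.NumberTheory.GaloisRepresentations.DiscreteGaloisModule
open Literature.NumberTheory.EllipticCurves Literature.NumberTheory.EllipticCurves.ModularForms
open Literature.NumberTheory.EllipticCurves.Rank1Residual
open Literature.NumberTheory.EllipticCurves.Kato2004
open Literature.NumberTheory.EllipticCurves.Kato2004.EulerSystemValues
open Summit.BirchSwinnertonDyer.Rank1Residual.GaloisImage
open Summit.BirchSwinnertonDyer.Rank1Residual.Additive.LocalLog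
open Summit.BirchSwinnertonDyer.BirchSwinnertonDyer.Theorems
open Summit.BirchSwinnertonDyer.BirchSwinnertonDyer.Theorems.KimAtThreeKolyvaginDefs
open Summit.BirchSwinnertonDyer.BirchSwinnertonDyer.Theorems.KimAtThreeDeepUpperLocalLatticeUniform
open Summit.BirchSwinnertonDyer.BirchSwinnertonDyer.Theorems.KimAtThreeDeepUpperRiderOfCompat
open Summit.BirchSwinnertonDyer.BirchSwinnertonDyer.Theorems.KimAtThreeShallowEqDeepMultTwoExpFineKato

namespace Summit.BirchSwinnertonDyer.BirchSwinnertonDyer.Theorems.KimAtThreeShallowEqDeepMultOfDefinedKato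

/-- Local notation: the TWO-EXPONENT rider clause (ii₂) at depth `j`, torsion slot `t`, defect exponent `e`,
place `v`, for the pair `(Λ, Λf)` (seat acc6's RIDER₂, VERBATIM). -/
local notation3 (prettyPrint := false) "RIDER₂⟦" W' ", " j ", " t' ", " e' ", " v' ", " Λ' ", " Λf "⟧" =>
  ∀ (r : Finset (HeightOneSpectrum (𝓞 ℚ)))
    (Ψ : H1 (tateRep W' 3) (cycSubgroup 3 0 r) →+
      continuousCohomology 1
        (subgroupRep (WeierstrassCurve.torsionGaloisModule W' (((3 : ℕ) : ℤ) ^ j * ((3 : ℕ) : ℤ))).toTopRep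
          (cycSubgroup 3 0 r))),
    (∀ (φ : contOneCocycles (subgroupRep (tateRep W' 3).toTopRep (cycSubgroup 3 0 r)))
        (ψ : contOneCocycles
          (subgroupRep (WeierstrassCurve.torsionGaloisModule W' (((3 : ℕ) : ℤ) ^ j * ((3 : ℕ) : ℤ))).toTopRep
            (cycSubgroup 3 0 r))),
        (∀ g, ((ψ.1 g : geomTorsion W' (((3 : ℕ) : ℤ) ^ j * ((3 : ℕ) : ℤ))) : geomPoints W') =
          TateModule.proj 3 (j + 1) (φ.1 g)) →
        Ψ (oneCocycleClass _ φ) = oneCocycleClass _ ψ) →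
    ∀ (y : H1 (tateRep W' 3) (cycSubgroup 3 0 r))
      (κ₀ : galoisCohomology (WeierstrassCurve.torsionGaloisModule W' (((3 : ℕ) : ℤ) ^ j * ((3 : ℕ) : ℤ))) 1)
      (s : ℤ_[3]),
      resSubgroup (WeierstrassCurve.torsionGaloisModule W' (((3 : ℕ) : ℤ) ^ j * ((3 : ℕ) : ℤ))).toTopRep
          (cycSubgroup 3 0 r) 1 κ₀ = Ψ y →
      galoisCohomology.localization (WeierstrassCurve.torsionGaloisModule W' (((3 : ℕ) : ℤ) ^ j * ((3 : ℕ) : ℤ)))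
          (Sum.inr v') 1 κ₀ ∈ propagatedSelmerStructure W' 3 j (Sum.inr v') →
      (∃ l ∈ cycIntLattice 3 (cycLevel 3 0 r),
          (((3 : ℕ) : ℤ_[3]) ^ t') • Λ' 0 r y - ((s : ℚ_[3]) ⊗ₜ[ℚ] (1 : CyclotomicField (cycLevel 3 0 r) ℚ)) =
            (((3 : ℕ) : ℤ_[3]) ^ (j + 1)) • (l : ℚ_[3] ⊗[ℚ] CyclotomicField (cycLevel 3 0 r) ℚ)) →
      ((3 ^ e' : ℕ) : ZMod (3 ^ (j + 1))) *
        Λf (galoisCohomology.localization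
          (WeierstrassCurve.torsionGaloisModule W' (((3 : ℕ) : ℤ) ^ j * ((3 : ℕ) : ℤ))) (Sum.inr v') 1 κ₀) =
        PadicInt.toZModPow (j + 1) s

/-- Local notation: the crude compatibility X1-int at depth `j` WITH EXPONENT `b := 1` between Kato's value datum
`Λ_{0,r}` and the scalar dual exponential `φ` at `v` (seat w2-c3's X1-int_b text with `b = 1`). -/
local notation3 (prettyPrint := false) "COMPAT₁⟦" W' ", " j ", " v' ", " Λ' ", " φ0 "⟧" =>
  ∀ (r : Finset (HeightOneSpectrum (𝓞 ℚ)))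
    (Ψ : H1 (tateRep W' 3) (cycSubgroup 3 0 r) →+
      continuousCohomology 1 (subgroupRep
        (WeierstrassCurve.torsionGaloisModule W' (((3 : ℕ) : ℤ) ^ j * ((3 : ℕ) : ℤ))).toTopRep (cycSubgroup 3 0 r))),
    (∀ (φ₁ : contOneCocycles (subgroupRep (tateRep W' 3).toTopRep (cycSubgroup 3 0 r)))
        (ψ : contOneCocycles (subgroupRep
          (WeierstrassCurve.torsionGaloisModule W' (((3 : ℕ) : ℤ) ^ j * ((3 : ℕ) : ℤ))).toTopRep (cycSubgroup 3 0 r))),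
        (∀ g, ((ψ.1 g : geomTorsion W' (((3 : ℕ) : ℤ) ^ j * ((3 : ℕ) : ℤ))) : geomPoints W') =
          TateModule.proj 3 (j + 1) (φ₁.1 g)) →
        Ψ (oneCocycleClass _ φ₁) = oneCocycleClass _ ψ) →
    ∀ (y : H1 (tateRep W' 3) (cycSubgroup 3 0 r))
      (κ₀ : galoisCohomology (WeierstrassCurve.torsionGaloisModule W' (((3 : ℕ) : ℤ) ^ j * ((3 : ℕ) : ℤ))) 1)
      (h : (tateLocalRep W' 3 (Sum.inr v')).cohomology 1),
      resSubgroup (WeierstrassCurve.torsionGaloisModule W' (((3 : ℕ) : ℤ) ^ j * ((3 : ℕ) : ℤ))).toTopRep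
          (cycSubgroup 3 0 r) 1 κ₀ = Ψ y →
      galoisCohomology.localization (WeierstrassCurve.torsionGaloisModule W' (((3 : ℕ) : ℤ) ^ j * ((3 : ℕ) : ℤ)))
          (Sum.inr v') 1 κ₀ = tateLocalMap W' 3 j (Sum.inr v') h →
      ∃ l ∈ cycIntLattice 3 (cycLevel 3 0 r),
        (((3 : ℕ) : ℤ_[3]) ^ (1 : ℕ)) • ((φ0 h ⊗ₜ[ℚ] (1 : CyclotomicField (cycLevel 3 0 r) ℚ)) - Λ' 0 r y) =
          (((3 : ℕ) : ℤ_[3]) ^ (j + 1)) • (l : ℚ_[3] ⊗[ℚ] CyclotomicField (cycLevel 3 0 r) ℚ)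

/-- Local notation: **(C1ₑₓ¹ᵘ) at the row `(W, v, P)`** — seat w2-c3's DEFINED-KATO package (C1ₑₓ) with the crude
exponent FIXED to `b = 1` and R-κ added: `(ι, κK, Λ, φ)` with `κK ≠ 0` a rational `3`-adic unit, `hker`, `hdual`,
COMPAT₁ at every depth, and Kato's `ZetaBody` family for `P.f`. -/
local notation3 (prettyPrint := false) "DEFKATO₁ᵘ⟦" W' ", " v' ", " N' ", " P' "⟧" =>
  ∃ (ι : (n : ℕ) → (CyclotomicField n ℚ →+* ℂ)) (κK : ℝ)
    (Λ : ∀ (k' : ℕ) (r : Finset (HeightOneSpectrum (𝓞 ℚ))),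
      H1 (tateRep W' 3) (cycSubgroup 3 k' r) →ₗ[ℤ_[3]] ℚ_[3] ⊗[ℚ] CyclotomicField (cycLevel 3 k' r) ℚ)
    (φ : (tateLocalRep W' 3 (Sum.inr v')).cohomology 1 →+ ℚ_[3]),
    κK ≠ 0 ∧ (∃ u : ℚ, (u : ℝ) = κK ∧ padicValRat 3 u = 0) ∧
    (∀ y, φ y = 0 ↔ ∀ j : ℕ, tateLocalMap W' 3 j (Sum.inr v') y ∈
      WeierstrassCurve.kummerSelmerStructure W' (((3 : ℕ) : ℤ) ^ j * ((3 : ℕ) : ℤ)) (Sum.inr v')) ∧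
    (∀ a : ℚ_[3], (∃ y, φ y = a) ↔
      ∀ Q : ((W' : WeierstrassCurve ℚ).baseChange ℚ_[3]).toAffine.Point,
        ‖a * padicLog ((W' : WeierstrassCurve ℚ).baseChange ℚ_[3]) Q‖ ≤ 1) ∧
    (∀ j : ℕ, COMPAT₁⟦W', j, v', Λ, φ⟧) ∧
    ∀ (c d a : ℤ) (A : ℕ), 0 < A → Int.gcd c (6 * 3 * A) = 1 → Int.gcd d (6 * 3 * N') = 1 →
      ∃ (z : ∀ (k' : ℕ) (r : (cyclotomicLevelsRat 3 (badPlaces c d A N')).Ideals),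
            H1 (tateRep W' 3) ((cyclotomicLevelsRat 3 (badPlaces c d A N')).level k' r.1))
        (x : ∀ (k' : ℕ) (r : (cyclotomicLevelsRat 3 (badPlaces c d A N')).Ideals),
            CyclotomicField (cycLevel 3 k' r.1) ℚ),
        ZetaBody W' 3 (P' : ModularParametrizationData W' N').f ι κK Λ c d a A z x

/-- Local notation: **(C1′₂) at the row `(W, v, P)`** (gen 10's `KimAtThreeShallowEqDeepMultTwoExpFineKato`,
VERBATIM). -/
local notation3 (prettyPrint := false) "FINEKATO₁₂⟦" W' ", " v' ", " N' ", " P' "⟧" =>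
  ∀ [ContinuousSMul ℤ_[3] (WeierstrassCurve.tateModule W' 3)] [Module.Free ℤ_[3] (WeierstrassCurve.tateModule W' 3)]
    [Module.Finite ℤ_[3] (WeierstrassCurve.tateModule W' 3)],
    ∃ (ι : (n : ℕ) → (CyclotomicField n ℚ →+* ℂ)) (κK : ℝ)
      (Λ : ∀ (k' : ℕ) (r : Finset (HeightOneSpectrum (𝓞 ℚ))),
        H1 (tateRep W' 3) (cycSubgroup 3 k' r) →ₗ[ℤ_[3]]
          ℚ_[3] ⊗[ℚ] CyclotomicField (cycLevel 3 k' r) ℚ)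
      (Λfin : ∀ j : ℕ, galoisCohomology
        ((WeierstrassCurve.torsionGaloisModule W' (((3 : ℕ) : ℤ) ^ j * ((3 : ℕ) : ℤ))).toLocal (Sum.inr v')) 1 →+
          ZMod (3 ^ (j + 1))) (e : ℕ),
      κK ≠ 0 ∧ (∃ u : ℚ, (u : ℝ) = κK ∧ padicValRat 3 u = 0) ∧
      (∀ j : ℕ,
        (∀ c : ZMod (3 ^ (j + 1)), ∃ x ∈ propagatedSelmerStructure W' 3 j (Sum.inr v'), Λfin j x = c) ∧
        (∀ x ∈ propagatedSelmerStructure W' 3 j (Sum.inr v'),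
          Λfin j x = 0 ↔ x ∈ WeierstrassCurve.kummerSelmerStructure W' (((3 : ℕ) : ℤ) ^ j * ((3 : ℕ) : ℤ)) (Sum.inr v'))) ∧
      (∀ j : ℕ, RIDER₂⟦W', j, 1, e, v', Λ, Λfin j⟧) ∧
      ∀ (c d a : ℤ) (A : ℕ), 0 < A → Int.gcd c (6 * 3 * A) = 1 → Int.gcd d (6 * 3 * N') = 1 →
        ∃ (z : ∀ (k' : ℕ) (r : (cyclotomicLevelsRat 3 (badPlaces c d A N')).Ideals),
              H1 (tateRep W' 3) ((cyclotomicLevelsRat 3 (badPlaces c d A N')).level k' r.1))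
          (x : ∀ (k' : ℕ) (r : (cyclotomicLevelsRat 3 (badPlaces c d A N')).Ideals),
              CyclotomicField (cycLevel 3 k' r.1) ℚ),
          ZetaBody W' 3 (P' : ModularParametrizationData W' N').f ι κK Λ c d a A z x

/-- Local notation: the UNLOCKED two-exponent port at `(W, v₃, η, P)`, torsion slot `0`, defect exponent `e`
(gen 7 PortRows' `hPort`, VERBATIM). -/
local notation3 (prettyPrint := false) "PORTU₂⟦" W' ", " e' ", " v' ", " η' ", " P' "⟧" =>
  ∀ (k k' : ℕ) (Dk : KolyvaginDatum (WeierstrassCurve.torsionGaloisModule W' (((3 : ℕ) : ℤ) ^ k * ((3 : ℕ) : ℤ))))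
    (Dk' : KolyvaginDatum (WeierstrassCurve.torsionGaloisModule W' (((3 : ℕ) : ℤ) ^ k' * ((3 : ℕ) : ℤ))))
    (red : (WeierstrassCurve.torsionGaloisModule W' (((3 : ℕ) : ℤ) ^ k' * ((3 : ℕ) : ℤ))).toContRepresentation →ⁱL
      (WeierstrassCurve.torsionGaloisModule W' (((3 : ℕ) : ℤ) ^ k * ((3 : ℕ) : ℤ))).toContRepresentation),
    Dk.IsCanonicalTauDatumThreeAtWith W' k k η' → Dk'.IsCanonicalTauDatumThreeAtWith W' k' k' η' → k ≤ k' →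
    (∀ x : geomTorsion W' (((3 : ℕ) : ℤ) ^ k' * ((3 : ℕ) : ℤ)),
      ((red x : geomTorsion W' (((3 : ℕ) : ℤ) ^ k * ((3 : ℕ) : ℤ))) : geomPoints W') =
        (((3 : ℕ) : ℤ) ^ (k' - k)) • (x : geomPoints W')) →
    ∃ κ Λ κ' κu Λu κu',
      KatoKuriharaWitnessAtTwoExp W' k 0 e' Dk v' P' κ Λ κ' ∧
      KatoKuriharaWitnessAtTwoExp W' k' 0 e' Dk' v' P' κu Λu κu' ∧
      ∀ d, Dk'.IsLevel d → Dk.IsLevel d →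
        galoisCohomology.map red 1 (κu d) = κ d ∧ galoisCohomology.map red 1 (κu' d) = κ' d

/-! ### §1 No `p`-torsion ⇒ the torsion subgroup has order prime to `p` -/

/-- **`#G[p] = 1 ⇒ p ∤ #G_tors`** for an abelian group `G` (Cauchy: a finite group of order divisible by `p`
has an element of order `p`; if `G_tors` is infinite its `Nat.card` is `0` and the valuation is `0` by convention).
[folklore] -/
theorem padicValNat_card_torsion_eq_zero_of_card_torsionBy_eq_one {G : Type*} [AddCommGroup G]
    (p : ℕ) [hp : Fact p.Prime] (ht : Nat.card {g : G // p • g = 0} = 1) :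
    padicValNat p (Nat.card (AddCommGroup.torsion G)) = 0 := by
  rcases Nat.eq_zero_or_pos (Nat.card (AddCommGroup.torsion G)) with h0 | hpos
  · simp [h0]
  · haveI : Finite (AddCommGroup.torsion G) := Nat.finite_of_card_ne_zero hpos.ne'
    refine padicValNat.eq_zero_of_not_dvd fun hdvd => ?_
    obtain ⟨g, hg⟩ := exists_prime_addOrderOf_dvd_card' (G := AddCommGroup.torsion G) p hdvd
    have hg0 : g ≠ 0 := by
      intro h
      rw [h, addOrderOf_zero] at hg
      exact hp.out.one_lt.ne' hg.symm
    have hpg : p • (g : G) = 0 := by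
      rw [← AddSubgroup.coe_nsmul, ← hg, addOrderOf_nsmul_eq_zero, AddSubgroup.coe_zero]
    haveI : Finite {g : G // p • g = 0} := Nat.finite_of_card_ne_zero (by rw [ht]; exact one_ne_zero)
    have hsub : Subsingleton {g : G // p • g = 0} := (Nat.card_eq_one_iff_unique.mp ht).1
    have heq := Subsingleton.elim (⟨(g : G), hpg⟩ : {g : G // p • g = 0}) ⟨0, by rw [nsmul_zero]⟩
    exact hg0 (Subtype.ext (by simpa using congrArg Subtype.val heq))

/-! ### §2 Normalising a dual-form `exp*_ω` at a `t = 0` row: `φ = 3^{λ₀}φ′` with `λ₀ ≥ −1` -/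

section Normalise

variable (W : WeierstrassCurve ℚ) [W.IsElliptic] [W.IsGloballyMinimal] (p : ℕ) [hp : Fact p.Prime]
  (v : Place ℚ) (φ : (tateLocalRep W p v).cohomology 1 →+ ℚ_[p])

set_option backward.isDefEq.respectTransparency false in
/-- **Normalisation with the exponent bound at a `t = 0` row.**  From kim3's displayed duality hypothesis `hdual`
(Tate local duality + [BK90] Prop. 3.8, lattice form) and `#E(ℚ_p)[p] = 1`: there are `λ₀ ≥ −1` and a NORMALISED
`φ′` (integral, onto `ℤ_p`) with `φ = p^{λ₀}φ′` — because `log_ω(E(ℚ_p)) = p^{1 + t − v_p(c_p) − v_p #Ẽ_ns(𝔽_p)}ℤ_p`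
on a minimal model (n1011's `range_padicLog_eq_span_zpow_of_isMinimal`) and `t = 0` (§1), so
`range φ = p^{λ₀}ℤ_p` with `λ₀ = v_p(c_p) + v_p #Ẽ_ns(𝔽_p) − 1`.  (Seat w2-c3's `exists_normalised_of_dual` with
the exponent made explicit.) [cite: BlochKato1990, §3 (Prop. 3.8, Ex. 3.11)]
[cite: Kim2022StructureSelmer, §3.2.3 (display before Thm. 3.7) and Lemma 3.3 / 3.10 (PDF pp. 16–17)]
[cite: SilvermanAEC2009, IV.6.4, VII.2.1 and VII.6.3] -/
theorem exists_normalised_of_dual_of_torsionBy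
    (hdual : ∀ a : ℚ_[p], (∃ y, φ y = a) ↔
      ∀ P : (W.baseChange ℚ_[p]).toAffine.Point, ‖a * padicLog (W.baseChange ℚ_[p]) P‖ ≤ 1)
    (ht : Nat.card {Q : (W.baseChange ℚ_[p]).toAffine.Point // (p : ℕ) • Q = 0} = 1) :
    ∃ (φ' : (tateLocalRep W p v).cohomology 1 →+ ℚ_[p]) (lam : ℤ), -1 ≤ lam ∧
      (∀ y, ‖φ' y‖ ≤ 1) ∧ (∀ s : ℤ_[p], ∃ y, φ' y = s) ∧
      (∀ y, φ y = (p : ℚ_[p]) ^ lam * φ' y) := by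
  haveI : (W.baseChange ℚ_[p]).IsMinimal ℤ_[p] := isMinimal_map_padic_of_isGloballyMinimal W p
  set e : ℤ := (1 : ℤ) + padicValNat p (Nat.card (AddCommGroup.torsion (W.baseChange ℚ_[p]).toAffine.Point)) -
      padicValNat p ((W.baseChange ℚ_[p]).localTamagawaNumber ℤ_[p]) -
      padicValNat p (Nat.card ((W.baseChange ℚ_[p]).reduction ℤ_[p]).toAffine.Point) with he
  have hrange := range_padicLog_eq_span_zpow_of_isMinimal (W.baseChange ℚ_[p])
  -- `a ∈ range φ ↔ ‖a · p^e‖ ≤ 1`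
  have hiff : ∀ a : ℚ_[p], (∃ y, φ y = a) ↔ ‖a * (p : ℚ_[p]) ^ e‖ ≤ 1 := by
    intro a
    rw [hdual a]
    constructor
    · intro h
      have hmem : (p : ℚ_[p]) ^ e ∈ (padicLog (W.baseChange ℚ_[p])).range := by
        rw [hrange, Submodule.mem_toAddSubgroup]
        exact Submodule.mem_span_singleton_self _
      obtain ⟨P, hP⟩ := hmem
      have h' := h P
      rwa [hP] at h'
    · intro ha P
      have hP : padicLog (W.baseChange ℚ_[p]) P ∈ (padicLog (W.baseChange ℚ_[p])).range := ⟨P, rfl⟩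
      rw [hrange, Submodule.mem_toAddSubgroup, Submodule.mem_span_singleton] at hP
      obtain ⟨c, hc⟩ := hP
      rw [← hc, Algebra.smul_def, PadicInt.algebraMap_apply, ← mul_assoc, mul_comm a, mul_assoc, norm_mul]
      exact mul_le_one₀ (PadicInt.norm_le_one c) (norm_nonneg _) ha
  have hp0 : (p : ℚ_[p]) ≠ 0 := Nat.cast_ne_zero.mpr hp.out.ne_zero
  have hpe : (p : ℚ_[p]) ^ e ≠ 0 := zpow_ne_zero e hp0
  -- the bound: `t = 0` ⇒ `e ≤ 1`
  have htors : padicValNat p (Nat.card (AddCommGroup.torsion (W.baseChange ℚ_[p]).toAffine.Point)) = 0 :=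
    padicValNat_card_torsion_eq_zero_of_card_torsionBy_eq_one p ht
  have hle : e ≤ 1 := by omega
  refine ⟨(AddMonoidHom.mulLeft ((p : ℚ_[p]) ^ e)).comp φ, -e, by omega, fun y => ?_, fun s => ?_, fun y => ?_⟩
  · rw [AddMonoidHom.comp_apply, AddMonoidHom.coe_mulLeft, mul_comm]
    exact (hiff (φ y)).mp ⟨y, rfl⟩
  · obtain ⟨y, hy⟩ := (hiff ((s : ℚ_[p]) * ((p : ℚ_[p]) ^ e)⁻¹)).mpr (by
      rw [inv_mul_cancel_right₀ hpe]; exact PadicInt.norm_le_one s)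
    refine ⟨y, ?_⟩
    rw [AddMonoidHom.comp_apply, AddMonoidHom.coe_mulLeft, hy, mul_comm, inv_mul_cancel_right₀ hpe]
  · rw [AddMonoidHom.comp_apply, AddMonoidHom.coe_mulLeft, ← mul_assoc, zpow_neg, inv_mul_cancel₀ hpe,
      one_mul]

end Normalise

/-! ### §3 (C1′₂) from the defined-Kato package with `b = 1` and a unit constant -/

section Row

variable (W : WeierstrassCurve ℚ) [W.IsElliptic] [W.IsGloballyMinimal]

omit [W.IsGloballyMinimal] in
/-- RIDER₂ at `(0, e)` for `3 • Λ` is RIDER₂ at `(1, e)` for `Λ` (the converse reading of gen 10's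
`KimAtThreeShallowEqDeepMultTwoExpPort.rider₂_smul`). [cite: Kim2022StructureSelmer, §3.2.3 and Lemma 3.3 (arXiv v3 pp. 16–18)] -/
theorem rider₂_one_of_smul [ContinuousSMul ℤ_[3] (W.tateModule 3)] {j e : ℕ} {v : HeightOneSpectrum (𝓞 ℚ)}
    {Λ : ∀ (k' : ℕ) (r : Finset (HeightOneSpectrum (𝓞 ℚ))),
      H1 (tateRep W 3) (cycSubgroup 3 k' r) →ₗ[ℤ_[3]] ℚ_[3] ⊗[ℚ] CyclotomicField (cycLevel 3 k' r) ℚ}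
    {Λf : galoisCohomology ((W.torsionGaloisModule (((3 : ℕ) : ℤ) ^ j * ((3 : ℕ) : ℤ))).toLocal
      (Sum.inr v)) 1 →+ ZMod (3 ^ (j + 1))}
    (h : RIDER₂⟦W, j, 0, e, v, (fun k' r => (((3 : ℕ) : ℤ_[3]) ^ (1 : ℕ)) • Λ k' r), Λf⟧) :
    RIDER₂⟦W, j, 1, e, v, Λ, Λf⟧ := by
  intro r Ψ hΨ y κ₀ s hres hloc hval
  refine h r Ψ hΨ y κ₀ s hres hloc ?_
  obtain ⟨l, hl, heq⟩ := hval
  refine ⟨l, hl, ?_⟩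
  rw [← heq, LinearMap.smul_apply, pow_zero, one_smul]

set_option backward.isDefEq.respectTransparency false in
/-- **(C1ₑₓ¹ᵘ) ⟹ (C1′₂) at a `t = 0` row.**  For a globally minimal `W`, a place `v₃ ∣ 3`, `#E(ℚ₃)[3] = 1` and a
parametrisation datum `P`: seat w2-c3's DEFINED-KATO package with the crude exponent `b = 1` and R-κ —
`(ι, κK, Λ, φ)` with `hker`, `hdual`, COMPAT₁ at every depth, `ZetaBody` — yields gen 10's fine package (C1′₂):
the finite-level functionals `Λfin_j` with the (Λ)-clauses come from the normalised `φ′ = 3^{−λ₀}φ`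
(`exists_finLevelFunctional_clauses_of_normalised`, `hker` transported), and the two-exponent riders at
`(1, e)`, `e = 1 + λ₀ ≥ 0` (§2), are seat w2-c3's `rider₂_of_compat` at `(a, b, t) = (1, 1, 0)` read back on `Λ`
(`rider₂_one_of_smul`).  NO digit is lost: the truth on a multiplicative row is `λ₀ = v₃(c₃) − 1`, `e = v₃(c₃)`;
on a good non-anomalous row `λ₀ = −1`, `e = 0`.  Nothing constructed; nothing booked.
[cite: BlochKato1990, §3 (Prop. 3.8, Ex. 3.11)] [cite: Kim2022StructureSelmer, §3.2.3, Lemma 3.3 / 3.10 / 3.11, Thm. 3.13]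
[cite: Kato2004Asterisque, §9.4 (p. 188) and Thm. 9.7 (p. 189)] [cite: MazurRubin2004, App. A, Prop. A.2] -/
theorem fineKato₁₂_of_definedKatoUnit {N : ℕ} [NeZero N] (P : ModularParametrizationData W N)
    {v₃ : HeightOneSpectrum (𝓞 ℚ)}
    (ht : Nat.card {Q : (W.baseChange ℚ_[3]).toAffine.Point // (3 : ℕ) • Q = 0} = 1)
    (hKU : ∀ [ContinuousSMul ℤ_[3] (W.tateModule 3)] [Module.Free ℤ_[3] (W.tateModule 3)]
      [Module.Finite ℤ_[3] (W.tateModule 3)], DEFKATO₁ᵘ⟦W, v₃, N, P⟧) :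
    FINEKATO₁₂⟦W, v₃, N, P⟧ := by
  intro _ _ _
  obtain ⟨ι, κK, Λ, φ, hκ0, hunit, hker, hdual, hcompat, hz⟩ := hKU
  -- normalise `φ = 3^{λ₀} φ′` with `λ₀ ≥ -1` (`t = 0`), transport `hker`, build `Λfin` with the (Λ)-clauses
  obtain ⟨φ', lam, hlam, hint', hsurj', hφ⟩ :=
    exists_normalised_of_dual_of_torsionBy W 3 (Sum.inr v₃) φ hdual ht
  have hc : (3 : ℚ_[3]) ^ lam ≠ 0 := zpow_ne_zero lam (by norm_num)
  have hker' := hker_of_eq_mul W 3 (Sum.inr v₃) φ hc hφ hker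
  obtain ⟨Λfin, hΛ, hI⟩ := exists_finLevelFunctional_clauses_of_normalised W 3 (Sum.inr v₃) φ' hint' hsurj' hker'
  -- the defect exponent `e = 1 + λ₀ ≥ 0`
  set e : ℕ := ((1 : ℤ) + lam).toNat with hedef
  have he : (e : ℤ) = ((0 : ℕ) : ℤ) + ((1 : ℕ) : ℤ) + lam := by
    rw [hedef, Int.toNat_of_nonneg (by omega)]; push_cast; ring
  -- RIDER₂ at `(0, e)` for `3 • Λ` from the crude compatibility at `b = 1`, then back to `(1, e)` for `Λ`
  have hfin₂ : ∀ j : ℕ, RIDER₂⟦W, j, 1, e, v₃, Λ, Λfin j⟧ := fun j =>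
    rider₂_one_of_smul W
      (rider₂_of_compat W v₃ Λ φ φ' lam hφ hint' j (Λfin j) (hI j) 1 (hcompat j) 1 0 e le_rfl he)
  exact ⟨ι, κK, Λ, Λfin, e, hκ0, hunit, hΛ, hfin₂, hz⟩

/-! ### §4 The unlocked two-exponent port and the rows of W2 from (C1ₑₓ¹ᵘ) + non-anomaly -/

/-- **The UNLOCKED two-exponent port at a non-additive NON-ANOMALOUS `t = 0` row FROM (C1ₑₓ¹ᵘ) ALONE** —
`∃ e`, gen 7 PortSeam's `hPortOff` text at `(W, v₃, η, P)` for every generator family `η` ⟸ surj(3) ∧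
`#E(ℚ₃)[3] = 1` ∧ `3 ∤ 3 + 𝟙_{3∤N} − a₃` ∧ the datum at the conductor ∧ (C1ₑₓ¹ᵘ): gen 10's
`portUnlockedTwoExp_of_fineKato₁₂_of_nonanomalous` on §3.  Nothing booked.
[cite: Kato2004Asterisque, (8.1.3) (p. 180), §9.4 (p. 188), Thm. 9.7 (p. 189), Thm. 6.6 (1) (p. 163) and Ex. 13.3 (pp. 224–225)]
[cite: Kim2022StructureSelmer, §3.2.3, Lemma 3.3 and Thm. 3.13 (arXiv v3 pp. 16–18, 26–28)] -/
theorem portUnlockedTwoExp_of_definedKatoUnit_of_nonanomalous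
    {N : ℕ} [NeZero N] (P : ModularParametrizationData W N) (hN : N = W.conductorNorm ℤ)
    (hsurj : W.HasSurjectiveModNGaloisRep ((3 : ℕ) : ℤ))
    {v₃ : HeightOneSpectrum (𝓞 ℚ)} (hv₃ : ((3 : ℕ) : 𝓞 ℚ) ∈ v₃.asIdeal)
    (ht : Nat.card {Q : (W.baseChange ℚ_[3]).toAffine.Point // (3 : ℕ) • Q = 0} = 1)
    {t₃ : ℤ} (ht₃ : cuspCoeff P.f 3 = t₃) (h3a : ¬ (3 : ℤ) ∣ 3 + (if 3 ∣ N then 0 else 1) - t₃)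
    (hKU : ∀ [ContinuousSMul ℤ_[3] (W.tateModule 3)] [Module.Free ℤ_[3] (W.tateModule 3)]
      [Module.Finite ℤ_[3] (W.tateModule 3)], DEFKATO₁ᵘ⟦W, v₃, N, P⟧)
    (η : (q : HeightOneSpectrum (𝓞 ℚ)) → (ZMod (Ideal.absNorm q.asIdeal))ˣ) :
    ∃ e : ℕ, PORTU₂⟦W, e, v₃, η, P⟧ :=
  portUnlockedTwoExp_of_fineKato₁₂_of_nonanomalous W P hN hsurj hv₃ ht ht₃ h3a
    (fineKato₁₂_of_definedKatoUnit W P ht hKU) η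

end Row

end Summit.BirchSwinnertonDyer.BirchSwinnertonDyer.Theorems.KimAtThreeShallowEqDeepMultOfDefinedKato

end
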